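import Summits.Ventures.HodgeRepro2.T5GlobalLatticeAlmostAll
import Summits.Ventures.HodgeRepro2.T5QuadraticCensusFinite
import Summits.Ventures.HodgeRepro2.T5InertGlobalPrime

/-!
# `S_bad` is contained in a finite set of places of the base field — the census, dyadic and lattice clauses
(cell pub-hodge-repro2, seat p3)

Tier-5 N3 support, §N3.10.3 of route/T5-N3-route-2.md: «`S_bad` := {non-split `v` : `E_v/F_v` ramified, or
`p = 2`, or one of (u2)–(u4) fails} is finite and read off `(E/F⁺, V, W₁₂, ψ)` alone» — an [A] line whose
finiteness argument is «`E_v/F_v` ramified or `p = 2` at finitely many `v`; a global `𝔬_E`-lattice of `V` (of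
`W₁₂`) is self-dual at all `v` outside a finite set; `ψ` has conductor `𝔬_{F_v}` outside the different». File 222
(`T5GlobalLatticeAlmostAll`) gives the lattice clause; seat p8's T5-181 (`T5QuadraticCensusFinite`) the census of
the places of a CM field outside a finite set (inert ⟺ `d` a non-square mod `v`, else split); here the clauses are
put together on Mathlib's `NumberField.IsCMField E` (`F⁺ = maximalRealSubfield E`):
* `finite_setOf_two_mem` — the dyadic places (`2 ∈ v`) of a number field are finitely many;
* **`exists_finite_census_and_good`** — for two matrices `H`, `H'` over `E` (the Gram matrices of `V` and of
  `W₁₂`) there are `d` and a FINITE set `S` of places of `F⁺` such that every `v ∉ S` is non-dyadic, has seat p8's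
  census (inert with its unique `w`, `e = 1`, `f = 2` ⟺ `d` a non-square mod `v`; split otherwise) and every
  `w ∣ v` is good for `H` and for `H'`;
* **`dualLattice_stdLattice_eq_of_staysPrime`** / `exists_algEquiv_dualLattice_stdLattice_eq_of_staysPrime` — at
  a place `v` that stays prime in `E` (`w` its unique place), for every non-trivial `σ ∈ Gal(E_w/F⁺_v)` (one
  exists, seat p8's T5-157) and seat p8's star `starRingOfQuadratic _ σ hσ`, the standard lattice of
  `𝒪_{E_v} = integralClosure O_{F⁺_v} E_w` is self-dual for every `H` with `det H ≠ 0` good at `w` — MVW's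
  (u3) for `V` and (u4) for `W₁₂` hold at every inert `v ∉ S`.
What is NOT here: (u2) — the conductor of the additive character `ψ` (no additive characters in the tree); which
lattice the record takes at the finitely many places of `S`.

Mathlib + this seat's file 222 + seat p8's T5-157 (T5InertGlobalPrime) / T5-181 (T5QuadraticCensusFinite) and
their imports; no display; no device. §8(d): uses an L-value-free non-vanishing device: NO.
-/

namespace Summit.Ventures.HodgeRepro2.T5BadPlacesFinite

open IsDedekindDomain IsDedekindDomain.HeightOneSpectrum NumberField Matrix
open Summit.Ventures.HodgeRepro2.T5UnitaryGroupIsometry Summit.Ventures.HodgeRepro2.T5StarOfInvolution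
  Summit.Ventures.HodgeRepro2.T5GlobalLatticeAlmostAll Summit.Ventures.HodgeRepro2.T5QuadraticCensusFinite
  Summit.Ventures.HodgeRepro2.T5InertGlobalPrime

/-! ## The dyadic places -/

section Dyadic

variable (K : Type*) [Field K] [NumberField K]

/-- The places of a number field of residue characteristic `2` (`2 ∈ v`) are finitely many: they divide `(2)`. -/
theorem finite_setOf_two_mem : {v : HeightOneSpectrum (𝓞 K) | (2 : 𝓞 K) ∈ v.asIdeal}.Finite := by
  refine (Ideal.finite_factors (I := Ideal.span {(2 : 𝓞 K)}) ?_).subset ?_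
  · rw [Ne, Submodule.zero_eq_bot, Ideal.span_singleton_eq_bot]
    exact two_ne_zero
  · intro v hv
    exact Ideal.dvd_span_singleton.mpr hv

end Dyadic

/-! ## The finite set outside which every clause holds -/

section CM

variable (E : Type*) [Field E] [NumberField E] [IsCMField E]
variable {ι : Type*} [Fintype ι] [DecidableEq ι]

/-- **`S_bad` IS CONTAINED IN A FINITE SET** (the census, dyadic and lattice clauses): for the CM field `E` over
`F⁺ = maximalRealSubfield E` and two matrices `H`, `H'` over `E`, there are `d ∈ 𝓞_{F⁺}` and a finite set `S` of
places of `F⁺` such that every `v ∉ S` (i) has seat p8's census (T5-181: `v` inert — one place `w ∣ v`,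
`e(w/v) = 1`, `f(w/v) = 2` — ⟺ `v` stays prime ⟺ `d` is a non-square mod `v`; `d` a square mod `v` ⇒ two places
over `v`), (ii) is non-dyadic, (iii) has every `w ∣ v` good for `H` and for `H'` (file 222's `badSet`). -/
theorem exists_finite_census_and_good (H H' : Matrix ι ι E) :
    ∃ (d : 𝓞 (maximalRealSubfield E)) (S : Set (HeightOneSpectrum (𝓞 (maximalRealSubfield E)))),
      S.Finite ∧ ∀ v ∉ S,
        (((∃ w : HeightOneSpectrum (𝓞 E), w.asIdeal.LiesOver v.asIdeal ∧
            (∀ w' : HeightOneSpectrum (𝓞 E), w'.asIdeal.LiesOver v.asIdeal → w' = w) ∧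
            v.asIdeal.ramificationIdx' w.asIdeal = 1 ∧ v.asIdeal.inertiaDeg' w.asIdeal = 2) ↔
          ¬ IsSquare (Ideal.Quotient.mk v.asIdeal d)) ∧
        ((∃ w : HeightOneSpectrum (𝓞 E),
            Ideal.map (algebraMap (𝓞 (maximalRealSubfield E)) (𝓞 E)) v.asIdeal = w.asIdeal) ↔
          ¬ IsSquare (Ideal.Quotient.mk v.asIdeal d)) ∧
        (IsSquare (Ideal.Quotient.mk v.asIdeal d) →
          ∃ w₁ w₂ : HeightOneSpectrum (𝓞 E), w₁ ≠ w₂ ∧ w₁.asIdeal.LiesOver v.asIdeal ∧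
            w₂.asIdeal.LiesOver v.asIdeal)) ∧
        (2 : 𝓞 (maximalRealSubfield E)) ∉ v.asIdeal ∧
        ∀ w : HeightOneSpectrum (𝓞 E), w.asIdeal.LiesOver v.asIdeal → w ∉ badSet H ∧ w ∉ badSet H' := by
  obtain ⟨d, S₀, hS₀, hcensus⟩ := exists_finite_census_cm E
  refine ⟨d, S₀ ∪ {v | (2 : 𝓞 (maximalRealSubfield E)) ∈ v.asIdeal} ∪
    {v | ∃ w : HeightOneSpectrum (𝓞 E), (w ∈ badSet H ∨ w ∈ badSet H') ∧ w.asIdeal.LiesOver v.asIdeal},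
    (hS₀.union (finite_setOf_two_mem _)).union
      (finite_setOf_exists_liesOver_mem_badSet_or (K := maximalRealSubfield E) H H'), ?_⟩
  intro v hv
  simp only [Set.mem_union, Set.mem_setOf_eq, not_or] at hv
  obtain ⟨⟨hv₀, hv₂⟩, hvb⟩ := hv
  refine ⟨hcensus v hv₀, hv₂, fun w hw => ⟨fun hb => hvb ⟨w, Or.inl hb, hw⟩, fun hb => hvb ⟨w, Or.inr hb, hw⟩⟩⟩

variable {E}
variable (v : HeightOneSpectrum (𝓞 (maximalRealSubfield E))) (w : HeightOneSpectrum (𝓞 E))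
  [w.asIdeal.LiesOver v.asIdeal]

/-- At a place `v` of `F⁺` that STAYS PRIME in `E` (`w` its unique place, seat p8's `hmap`), the local degree is
`2` (seat p8's T5-157 on Mathlib's `[E : F⁺] = 2`). -/
theorem finrank_adicCompletion_eq_two_of_staysPrime'
    (hmap : Ideal.map (algebraMap (𝓞 (maximalRealSubfield E)) (𝓞 E)) v.asIdeal = w.asIdeal) :
    Module.finrank (v.adicCompletion (maximalRealSubfield E)) (w.adicCompletion E) = 2 :=
  finrank_adicCompletion_eq_two_of_staysPrime v w
    (Algebra.IsQuadraticExtension.finrank_eq_two (maximalRealSubfield E) E) hmap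

/-- **MVW's (u3)/(u4) AT EVERY INERT PLACE OUTSIDE THE BAD SET**: at a place `v` of `F⁺` that stays prime in `E`,
for every non-trivial `σ ∈ Gal(E_w/F⁺_v)` and seat p8's star `star = σ`, the standard lattice of
`𝒪_{E_v} = integralClosure O_{F⁺_v} E_w` is self-dual for every `H` over `E` with `det H ≠ 0` that is good at
`w` (file 222's `dualLattice_stdLattice_eq_adicCompletion_integralClosure`). -/
theorem dualLattice_stdLattice_eq_of_staysPrime
    (hmap : Ideal.map (algebraMap (𝓞 (maximalRealSubfield E)) (𝓞 E)) v.asIdeal = w.asIdeal)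
    (σ : (w.adicCompletion E) ≃ₐ[v.adicCompletion (maximalRealSubfield E)] (w.adicCompletion E)) (hσ : σ ≠ 1)
    {H : Matrix ι ι E} (hdet : IsUnit H.det) (hw : w ∉ badSet H) :
    letI := starRingOfQuadratic (finrank_adicCompletion_eq_two_of_staysPrime' v w hmap) σ hσ
    dualLattice (integralClosure (v.adicCompletionIntegers (maximalRealSubfield E)) (w.adicCompletion E))
        (H.map (algebraMap E (w.adicCompletion E)))
        (stdLattice (integralClosure (v.adicCompletionIntegers (maximalRealSubfield E)) (w.adicCompletion E))) =
      stdLattice (integralClosure (v.adicCompletionIntegers (maximalRealSubfield E)) (w.adicCompletion E)) :=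
  dualLattice_stdLattice_eq_adicCompletion_integralClosure v w
    (finrank_adicCompletion_eq_two_of_staysPrime' v w hmap) σ hσ hdet hw

/-- The same with the non-trivial `σ` SUPPLIED (seat p8's `exists_algEquiv_ne_one_of_staysPrime`): at a place that
stays prime, outside the bad set of `H`, a self-dual standard lattice exists for some `σ ≠ 1`. -/
theorem exists_algEquiv_dualLattice_stdLattice_eq_of_staysPrime
    (hmap : Ideal.map (algebraMap (𝓞 (maximalRealSubfield E)) (𝓞 E)) v.asIdeal = w.asIdeal)
    {H : Matrix ι ι E} (hdet : IsUnit H.det) (hw : w ∉ badSet H) :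
    ∃ (σ : (w.adicCompletion E) ≃ₐ[v.adicCompletion (maximalRealSubfield E)] (w.adicCompletion E))
      (hσ : σ ≠ 1),
      letI := starRingOfQuadratic (finrank_adicCompletion_eq_two_of_staysPrime' v w hmap) σ hσ
      dualLattice (integralClosure (v.adicCompletionIntegers (maximalRealSubfield E)) (w.adicCompletion E))
          (H.map (algebraMap E (w.adicCompletion E)))
          (stdLattice (integralClosure (v.adicCompletionIntegers (maximalRealSubfield E))
            (w.adicCompletion E))) =
        stdLattice (integralClosure (v.adicCompletionIntegers (maximalRealSubfield E)) (w.adicCompletion E)) := by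
  obtain ⟨σ, hσ⟩ := exists_algEquiv_ne_one_of_staysPrime v w
    (Algebra.IsQuadraticExtension.finrank_eq_two (maximalRealSubfield E) E) hmap
  exact ⟨σ, hσ, dualLattice_stdLattice_eq_of_staysPrime v w hmap σ hσ hdet hw⟩

end CM

end Summit.Ventures.HodgeRepro2.T5BadPlacesFinite
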